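import Literature.Geometry.Symplectic.PlanarContactBoundary
import Literature.Topology.FourManifolds.MappingTorus
import Literature.Topology.FourManifolds.PlanarPage
import HarnessLib

/-!
# Planar monodromy of an open book: "`(B, π)` has page `P_n` and monodromy `φ ∈ ArcData n`",
# positively framed bindings, and the cite fact that a planar supporting open book has a model
# monodromy chart

Topic `Literature/Geometry/Symplectic`; second brick (D-a) of the vocabulary programme G3 of the
crux `ConvexBisection.PlanarAcyclicBisectionRigidity`
(`Summits/SmoothPoincare4/SmoothPoincare4/Cruxes/PlanarAcyclicBisectionRigidity/DictionaryDesign.md`,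
§2 Decisions 1–2 and §3 D-a, which this file follows in statement), over the tree's open books
(`Literature.Geometry.Symplectic.OpenBook`, `PlanarContactBoundary.lean`), the topological
mapping torus (`Literature.Topology.FourManifolds.MappingTorus`, `MappingTorus.lean`) and the model planar page with the
semantics of arc data (`Literature.Topology.FourManifolds.PlanarPage`, `PlanarPage.IsRealisedBy`,
`PlanarPage.lean`).

## Content (definitions are real; ONE named fact at the end)

* `anglePt t = (cos 2πt, sin 2πt) ∈ ℝ²`, `circlePoint t ∈ 𝕊¹`; `thinTubes K r` = the open tubes
  `⋃ᵢ tube i (𝕊¹ × B(0, r))` of radius `r` about the binding.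
* `IsMonodromyChart K n f r σ Φ` — RELATIONAL monodromy (Decision 1: a first-return map is not
  constructible from the fields of `OpenBook` without flows; we only NAME the chart): `Φ` is a
  continuous injection of the mapping torus of `f⁻¹` (whose first-return map in the positive
  `t`-direction is `f`, by the convention `MappingTorus.mk_apply_add_one`) ONTO the complement of
  the thin tubes, page-by-angle (`proj ∘ Φ (x, t) = anglePt t`), matching the boundary circle `l`
  of the page (`PlanarPage.bdryPt`, in its boundary orientation) with the core direction of the
  tube `σ l` at radius `r` (`Φ (bdryPt l s, t) = tube (σ l) (circlePoint s, r · anglePt t)`).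
  The radius `r` is quantified because `OpenBook` does not make tube IMAGES disjoint.
* `OpenBook.HasPlanarMonodromy K n φ` — the open book has page `P_n` and monodromy the arc datum
  `φ`: `φ` permutes no hole, is realised (`IsRealisedBy`) by some homeomorphism `f` of the page,
  and `(K, f)` admit a monodromy chart.
* `coreVelocity K i s` — the honest velocity of the core `s ↦ tube i (circlePoint s, 0)` of the
  `i`-th binding component (no chart of the circle involved); `IsPositivelyFramed K α` — the Giroux
  form is positive on these velocities (Decision 2: `OpenBook` alone does not orient the binding;
  a Giroux form does, and this predicate pins the tube directions to that orientation, so that the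
  monodromy read through the chart is the contact-geometric one, whose Wendl factorisation is into
  RIGHT-handed twists = the tree's positive letters).
* named fact `supportedPlanarMonodromy` (F-a).

## What is NOT here
No construction of a chart (flows), no uniqueness of `(n, φ)` (Alexander method / conjugacy in
`Mod(P_n)` — cite facts F0), no Lefschetz bodies (D-b), no statement of Wendl's theorem (F-W).

## References
* J. B. Etnyre, *Lectures on open book decompositions and contact structures*, Clay Math. Proc. 5
  (2006), §2 (Def. 2.1, Lemma 2.3 — arXiv:math/0409402 numbering — and the discussion "(B, π) determines an abstract open book"),
  Def. 3.2. [Etnyre2006]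
* B. Farb, D. Margalit, *A Primer on Mapping Class Groups* (2012), §1.3, §2.3 Prop. 2.8. [FarbMargalit2012]
-/

noncomputable section

open Set Function Real
open scoped _root_.Manifold _root_.ContDiff _root_.Topology
open _root_.Literature.Topology.FourManifolds (PlanarPage MappingTorus)
open _root_.Literature.Topology.FourManifolds.PlanarWords (ArcData)

namespace Literature.Geometry.Symplectic

/-- Local notation: `𝔼 n` is the model Euclidean space `EuclideanSpace ℝ (Fin n)`. -/
local notation "𝔼 " n:arg => EuclideanSpace ℝ (Fin n)

/-- Local notation: `𝕊 n` is the unit sphere in `EuclideanSpace ℝ (Fin (n + 1))`. -/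
local notation "𝕊 " n:arg => (Metric.sphere (0 : EuclideanSpace ℝ (Fin (n + 1))) 1)

universe u

/-! ### Angles -/

/-- The point of the plane at angle `2πt`: `(cos 2πt, sin 2πt)`. [folklore] -/
def anglePt (t : ℝ) : 𝔼 2 := WithLp.toLp 2 ![Real.cos (2 * π * t), Real.sin (2 * π * t)]

/-- `anglePt t` is a unit vector. [folklore] -/
@[simp] theorem norm_anglePt (t : ℝ) : ‖anglePt t‖ = 1 := by
  rw [EuclideanSpace.norm_eq, Real.sqrt_eq_one, Fin.sum_univ_two]
  simp [anglePt, Real.cos_sq_add_sin_sq]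

/-- `anglePt` is `1`-periodic. [folklore] -/
theorem anglePt_add_one (t : ℝ) : anglePt (t + 1) = anglePt t := by
  have h : 2 * π * (t + 1) = 2 * π * t + 2 * π := by ring
  simp [anglePt, h, Real.cos_add_two_pi, Real.sin_add_two_pi]

/-- `anglePt` is continuous. [folklore] -/
theorem continuous_anglePt : Continuous anglePt := by
  unfold anglePt
  refine (PiLp.continuous_toLp 2 _).comp ?_
  refine continuous_pi fun i => ?_
  fin_cases i <;> simp <;> fun_prop

/-- The point of the unit circle `𝕊¹ ⊂ ℝ²` at angle `2πt`. [folklore] -/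
def circlePoint (t : ℝ) : 𝕊 1 := ⟨anglePt t, by simp⟩

/-- `circlePoint` is `1`-periodic. [folklore] -/
theorem circlePoint_add_one (t : ℝ) : circlePoint (t + 1) = circlePoint t :=
  Subtype.ext (anglePt_add_one t)

/-! ### Monodromy charts -/

variable {N : Type u} [TopologicalSpace N] [ChartedSpace (𝔼 3) N] [IsManifold (𝓡 3) ∞ N]

/-- The open tubes of radius `r` about the binding: `⋃ᵢ tube i (𝕊¹ × B(0, r))`. [folklore] -/
def thinTubes (K : OpenBook N) (r : ℝ) : Set N :=
  ⋃ i, K.tube i '' (univ ×ˢ Metric.ball (0 : 𝔼 2) r)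

/-- **A MONODROMY CHART of the open book `K` with planar page `P_n` and first-return map `f`.**
`Φ` is a continuous injection of the mapping torus of `f⁻¹` — by the convention
`MappingTorus.mk_apply_add_one`, `mk f⁻¹ (f⁻¹ x) (t + 1) = mk f⁻¹ x t`, so `mk x (t + 1) = mk (f x) t`:
following the positive `t`-direction once around returns to the page through `f` — ONTO the
complement of the open tubes of radius `r`, sending the page slice at parameter `t` into the page
of angle `2πt` (`proj_eq`), and sending the boundary circle `l` of the page slice (`none` = outer,
`some j` = hole `j`, each in its boundary orientation, `PlanarPage.bdryPt`), at parameter `s`, to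
the point of the tube `σ l` with core parameter `s` and radial coordinate `r · anglePt t`
(`boundary`; consistent with `proj_eq` by `OpenBook.proj_tube`).  Thus the closure of every page
is the compact surface `P_n` with `n + 1` boundary circles on the `n + 1 = K.k` binding
components, and `f` is the monodromy.  (Etnyre 2006, §2: an open book `(B, π)` is, off a
neighbourhood of `B`, the mapping torus `Σ_φ` of the monodromy; Etnyre 2006, Lemma 2.3 in the arXiv numbering.)
[cite: Etnyre2006, §2 Lemma 2.3 (arXiv numbering)] -/
structure IsMonodromyChart (K : OpenBook N) (n : ℕ) (f : PlanarPage n ≃ₜ PlanarPage n) (r : ℝ)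
    (σ : Option (Fin n) ≃ Fin K.k) (Φ : MappingTorus f.symm → N) : Prop where
  /-- `Φ` is continuous … -/
  continuous : Continuous Φ
  /-- … injective … -/
  injective : Injective Φ
  /-- … onto the complement of the open `r`-tubes about the binding -/
  range_eq : range Φ = (thinTubes K r)ᶜ
  /-- the page slice at parameter `t` lies in the page of angle `2πt` -/
  proj_eq : ∀ (x : PlanarPage n) (t : ℝ), ((K.proj (Φ (MappingTorus.mk f.symm x t)) : 𝕊 1) : 𝔼 2) = anglePt t
  /-- the boundary circle `l` of the page slice goes to the tube `σ l` at radius `r`, matching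
  the core parameter with the boundary parametrisation and the polar angle with `t` -/
  boundary : ∀ (l : Option (Fin n)) (s t : ℝ),
    Φ (MappingTorus.mk f.symm (PlanarPage.bdryPt n l s) t) = K.tube (σ l) (circlePoint s, r • anglePt t)

/-- **The open book `K` HAS PLANAR PAGE `P_n` AND MONODROMY `φ ∈ ArcData n`**: the arc datum
permutes no hole, it is realised (`PlanarPage.IsRealisedBy`: outer circle fixed, holes fixed without
rotation, `δ_j ↦ u_j · δ_j`) by a homeomorphism `f` of the model page, and `K` admits a monodromy
chart with first-return map `f` for some tube radius `r > 0` and some matching `σ` of the boundary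
circles of the page with the binding components. [folklore] -/
def OpenBook.HasPlanarMonodromy (K : OpenBook N) (n : ℕ) (φ : ArcData n) : Prop :=
  φ.perm = 1 ∧ ∃ f : PlanarPage n ≃ₜ PlanarPage n, PlanarPage.IsRealisedBy n φ f ∧
    ∃ (r : ℝ) (σ : Option (Fin n) ≃ Fin K.k) (Φ : MappingTorus f.symm → N), 0 < r ∧ IsMonodromyChart K n f r σ Φ

/-! ### Positively framed bindings -/

/-- **The velocity of the core of the `i`-th binding tube** at parameter `s`: the manifold
derivative of `s ↦ tube i (circlePoint s, 0)` applied to `∂_s` (read in the preferred chart at the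
point; no chart of the circle is involved, so its direction is the tube's own). [folklore] -/
def coreVelocity (K : OpenBook N) (i : Fin K.k) (s : ℝ) : 𝔼 3 :=
  mfderiv 𝓘(ℝ, ℝ) (𝓡 3) (fun s : ℝ => K.tube i (circlePoint s, 0)) s 1

/-- **The open book is POSITIVELY FRAMED for the 1-form `α`**: `α` is positive on the velocity of
every binding core in the direction of its tube parametrisation.  For a Giroux form `α`
(`OpenBook.IsGirouxForm`) this says that the tube directions ARE the orientation of the binding as
the boundary of the pages (for the orientation of `N` by `α ∧ dα`), i.e. that a monodromy chart
reads the pages with their contact orientation — so that positive factorisations of the monodromy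
are factorisations into right-handed Dehn twists (DictionaryDesign.md §2, Decision 2).  Tube
directions are a gauge freedom of `OpenBook`, so this is achievable by re-tubing. [folklore] -/
def IsPositivelyFramed (K : OpenBook N) (α : Kaehler.MForm (𝓡 3) N ℝ 1) : Prop :=
  ∀ (i : Fin K.k) (s : ℝ), 0 < α (K.tube i (circlePoint s, 0)) ![coreVelocity K i s]

/-! ### The cite fact: a planar supporting open book has a positively framed model monodromy chart -/

/-- **A planar open book supporting a contact structure has, after re-tubing, a positively framed
monodromy chart with page `P_n` and monodromy an arc datum** (F-a of the programme).  For a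
connected closed 3-manifold `N`, an open book `K` with planar pages and a Giroux form `α` for the
plane field `ξ`: there is an open book `K'` with the SAME fibration and binding (`K'.proj = K.proj`,
`K'.binding = K.binding`; only the tube parametrisations may change — their directions are a gauge
freedom, and a thinner re-parametrised tube is again in Wendl's normal form), still with Giroux form
`α`, positively framed for `α`, whose pages are the model planar page `P_n` with monodromy an arc
datum `φ` (`HasPlanarMonodromy`).  Assembled from: an open book decomposition `(B, π)` of a closed
3-manifold is the relative mapping torus of its monodromy off a neighbourhood of the binding
(Etnyre 2006, §2, Lemma 2.3 in the arXiv:math/0409402 numbering, and the paragraph "(B, π) determines an abstract open book"); on a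
connected `N` the pages are connected, and a compact connected planar surface with `n + 1` boundary
circles is homeomorphic to `P_n` (classification of surfaces); a homeomorphism of `P_n` fixing the
boundary pointwise has arc data (every arc from `p₀` to `q_j` is homotopic rel end points to
`u · δ_j` for a loop `u`, and `π₁(P_n, p₀)` is free on the lassos — Farb–Margalit 2012, §1.3,
Prop. 2.8).  Users take `(h : supportedPlanarMonodromy)`.
-- TODO(general form): pages of any genus (abstract open books `(Σ, φ)`), and uniqueness of
-- `(n, φ)` up to conjugation in `Mod(P_n, ∂)`.
[cite: Etnyre2006, §2 Lemma 2.3 (arXiv numbering)] [cite: FarbMargalit2012, §1.3 and Prop. 2.8] -/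
def supportedPlanarMonodromy : Prop :=
  ∀ (N : Type) [TopologicalSpace N] [T2Space N] [CompactSpace N] [ConnectedSpace N]
    [ChartedSpace (EuclideanSpace ℝ (Fin 3)) N] [IsManifold (𝓡 3) ∞ N]
    (K : OpenBook N) (ξ : N → Submodule ℝ (EuclideanSpace ℝ (Fin 3))) (α : Kaehler.MForm (𝓡 3) N ℝ 1),
    K.IsPlanar → K.IsGirouxForm ξ α →
    ∃ (K' : OpenBook N) (n : ℕ) (φ : ArcData n), K'.proj = K.proj ∧ K'.binding = K.binding ∧
      K'.IsGirouxForm ξ α ∧ IsPositivelyFramed K' α ∧ K'.HasPlanarMonodromy n φ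

end Literature.Geometry.Symplectic

end
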